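import Mathlib
import HarnessLib
import Literature.Computability.AlgebraicComplexity.AsymptoticSpectrum
import Literature.Computability.AlgebraicComplexity.BorderRankCW
import Literature.Computability.AlgebraicComplexity.BILPS19MinrankVarieties
import Literature.Computability.AlgebraicComplexity.DegenerationSpectralMonotone
import Literature.Barriers.MatrixMultiplication.UniversalMethodBarrier
import Summits.MatrixMultiplication.MatrixMultiplication.Theorems.SoloInformedConverseDoorLimit
import Summits.MatrixMultiplication.MatrixMultiplication.Theorems.OutsiderSandwichPolystableRigidity
import Summits.MatrixMultiplication.MatrixMultiplication.Theorems.OutsiderSandwichCwTwoPowPolystable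
import Summits.MatrixMultiplication.MatrixMultiplication.Theorems.OutsiderSandwichUnitKroneckerRigidity
import Summits.MatrixMultiplication.MatrixMultiplication.Theorems.OutsiderSandwichMinrankGap
import Summits.MatrixMultiplication.MatrixMultiplication.Theorems.OutsiderSandwichRestrictionGap
import Summits.MatrixMultiplication.MatrixMultiplication.Theorems.OutsiderSandwichDegenerationBridge
import Summits.MatrixMultiplication.MatrixMultiplication.Theorems.OutsiderSandwichMinrankExact
import Summits.MatrixMultiplication.MatrixMultiplication.Theorems.OutsiderSandwichTwoSidedGap
import Summits.MatrixMultiplication.MatrixMultiplication.Theorems.OutsiderSandwichSliceParity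

/-!
# OutsiderSandwich — the finite shadow of the exchange ladder is empty: for every `N ≥ 1`, `⟨n⟩ ⊠ cw₂^{⊠N}`
and every padded matrix-multiplication tensor `⟨n'⟩ ⊠ ⟨m,m,m⟩` of the same format are degeneration-incomparable
(lens-4 g33, K33-F part 2; completes the finite-level calibration begun in `OutsiderSandwichMinrankGap`)

Route-independent support kernel (no `Theses` import, no new definitions).

Two `GL³`-invariants of the slice pencil, transported along the Kempf–Ness isomorphism
`w₁ = c • (s₁ ⊗ s₂ ⊗ s₃)·w₀` that every degeneration between polystable tensors is
(`exists_smul_sl3_eq_of_degeneratesTo`):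
`minrank` gives `m = 2^N` (`OutsiderSandwichTwoSidedGap.eq_two_pow_of_degeneratesTo`), and slice-rank parity —
all slices of `⟨n'⟩ ⊠ ⟨m,m,m⟩` have rank `≡ 0 (mod m)`, while `⟨n⟩ ⊠ cw₂^{⊠N}` has a slice of rank `3^N`
(`OutsiderSandwichSliceParity`) — gives `m ∣ 3^N` (`dvd_three_pow_of_degeneratesTo`, both directions).
Together: impossible for `N ≥ 1`.

* `not_degeneratesTo_of_pos` / `not_degeneratesTo_rev_of_pos`: for `N ≥ 1`, `n', m ≥ 1` and EVERY relabelling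
  `e`, neither of `⟨n⟩ ⊠ cw₂^{⊠N}`, `e^*(⟨n'⟩ ⊠ ⟨m,m,m⟩)` degenerates to the other; hence in equal formats
  `n·3^N = n'·m²` no restriction, no `ℂ[ε]`-degeneration of any order, no Alman degeneration, in either direction
  (`not_restrictsTo_of_pos`, `not_algDegeneratesTo_of_pos`, `not_polyDegeneratesTo_of_pos`);
* the g31/g32 exchange ladder: for ALL `p`, all `q ≥ 1`, `L ≥ 1` the two sides `⟨4^{pL}⟩ ⊠ cw₂^{⊠qL}`,
  `⟨3^{qL}⟩ ⊠ ⟨2^{pL},2^{pL},2^{pL}⟩` of rung `p/q` are degeneration-incomparable — including the slope-one rungs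
  `p = q` that `minrank` alone could not decide (`rung_incomparable`; `⟨4⟩ ⊠ cw₂^{⊠1}` vs `⟨3⟩ ⊠ ⟨2,2,2⟩`).

Honest tag: `ω`-free NEGATIVE CALIBRATION, complete at finite level: the equal-format finite shadow of the
exchange ladder is EMPTY — every rung is an intrinsically asymptotic statement (the `o(L)` slack and the format
drop of `≲` are essential; the theorems are uniform in the unit multiplicities `n, n'`, so finite unit catalysts
do not help), which is where the residual crux `LaserMergeOptimal` lives.

References: [cite: KempfNess1979, Thm. 0.2]; [cite: BlaserIkenmeyerLysikovPandeySchreyer2019, Def. 13, Lemma 18];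
[cite: ChristandlVranaZuiddam2023, Example 1.4]; [cite: BurgisserClausenShokrollahi1997, (14.22), (15.19)];
[cite: Alman2021, §2.4]; [cite: Strassen1988, Thm. 3.8].
-/

noncomputable section

open scoped BigOperators Matrix

open Literature.Computability.AlgebraicComplexity
open Literature.Barriers.MatrixMultiplication

namespace Summit.MatrixMultiplication.MatrixMultiplication.Theorems.OutsiderSandwichFiniteShadow

open OutsiderSandwichPolystableRigidity OutsiderSandwichCwTwoPowPolystable
  OutsiderSandwichUnitKroneckerRigidity OutsiderSandwichMinrankGap OutsiderSandwichRestrictionGap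
  OutsiderSandwichDegenerationBridge OutsiderSandwichMinrankExact OutsiderSandwichTwoSidedGap
  OutsiderSandwichSliceParity

/-! ## §1  Parity: a degeneration in either direction forces `m ∣ 3^N`; incomparability for `N ≥ 1` -/

section Parity

/-- **A degeneration `⟨n⟩ ⊠ cw₂^{⊠N} ⊵ e^*(⟨n'⟩ ⊠ ⟨m,m,m⟩)` forces `m ∣ 3^N`.** [cite: KempfNess1979, Thm. 0.2]
[cite: BlaserIkenmeyerLysikovPandeySchreyer2019, Lemma 18] -/
theorem dvd_three_pow_of_degeneratesTo {n N n' m : ℕ} (hn' : 0 < n') (hm : 0 < m)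
    (e : (Fin n × (Fin N → Fin 3)) ≃ (Fin n' × (Fin m × Fin m)))
    (hdeg : TensorDegeneratesTo (kroneckerTensor (unitTensor ℂ n) (kroneckerPow (cwTensor ℂ 2) N))
      (fun a b c => kroneckerTensor (unitTensor ℂ n') (matMulTensor ℂ m m m) (e a) (e b) (e c))) :
    m ∣ 3 ^ N := by
  classical
  have hn : 0 < n := Fin.pos (e.symm (⟨0, hn'⟩, (⟨0, hm⟩, ⟨0, hm⟩))).1
  haveI : Nonempty (Fin n × (Fin N → Fin 3)) := ⟨e.symm (⟨0, hn'⟩, (⟨0, hm⟩, ⟨0, hm⟩))⟩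
  obtain ⟨c, s, hc, hiso⟩ := exists_smul_sl3_eq_of_degeneratesTo hdeg
    (isPolystableTensor_unitKronecker_cwTwoPow n N)
    (isPolystableTensor_relabel e (isPolystableTensor_unitKronecker_matMul n' m))
    (relabel_unitKronecker_matMul_ne_zero hn' hm e)
  set x₀ : Fin n × (Fin N → Fin 3) → ℂ := fun a => if a.1 = (⟨0, hn⟩ : Fin n) then (1 : ℂ) else 0
    with hx₀
  have hcw := rank_contract3_unitKronecker_cwTwoPow_blockOnes (N := N) (⟨0, hn⟩ : Fin n)
  have hy := rank_contract3_smul_actTensor hc s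
    (kroneckerTensor (unitTensor ℂ n) (kroneckerPow (cwTensor ℂ 2) N))
    (Matrix.vecMul x₀ (s.1 : Matrix _ _ ℂ)⁻¹)
  rw [vecMul_inv_vecMul, hx₀, hcw, ← hiso] at hy
  rw [← hy]
  exact dvd_rank_contract3_relabel_unitKronecker_matMul e _

/-- **The reverse degeneration `e^*(⟨n'⟩ ⊠ ⟨m,m,m⟩) ⊵ ⟨n⟩ ⊠ cw₂^{⊠N}` also forces `m ∣ 3^N`.**
[cite: KempfNess1979, Thm. 0.2] [cite: BlaserIkenmeyerLysikovPandeySchreyer2019, Lemma 18] -/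
theorem dvd_three_pow_of_degeneratesTo_rev {n N n' m : ℕ} (hn' : 0 < n') (hm : 0 < m)
    (e : (Fin n × (Fin N → Fin 3)) ≃ (Fin n' × (Fin m × Fin m)))
    (hdeg : TensorDegeneratesTo
      (fun a b c => kroneckerTensor (unitTensor ℂ n') (matMulTensor ℂ m m m) (e a) (e b) (e c))
      (kroneckerTensor (unitTensor ℂ n) (kroneckerPow (cwTensor ℂ 2) N))) :
    m ∣ 3 ^ N := by
  classical
  have hn : 0 < n := Fin.pos (e.symm (⟨0, hn'⟩, (⟨0, hm⟩, ⟨0, hm⟩))).1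
  haveI : Nonempty (Fin n × (Fin N → Fin 3)) := ⟨e.symm (⟨0, hn'⟩, (⟨0, hm⟩, ⟨0, hm⟩))⟩
  obtain ⟨c, s, hc, hiso⟩ := exists_smul_sl3_eq_of_degeneratesTo hdeg
    (isPolystableTensor_relabel e (isPolystableTensor_unitKronecker_matMul n' m))
    (isPolystableTensor_unitKronecker_cwTwoPow n N)
    (unitKronecker_cwTwoPow_ne_zero hn)
  set x₀ : Fin n × (Fin N → Fin 3) → ℂ := fun a => if a.1 = (⟨0, hn⟩ : Fin n) then (1 : ℂ) else 0
    with hx₀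
  have hcw := rank_contract3_unitKronecker_cwTwoPow_blockOnes (N := N) (⟨0, hn⟩ : Fin n)
  have hy := rank_contract3_smul_actTensor hc s
    (fun a b c => kroneckerTensor (unitTensor ℂ n') (matMulTensor ℂ m m m) (e a) (e b) (e c)) x₀
  rw [← hiso, hx₀, hcw] at hy
  rw [hy]
  exact dvd_rank_contract3_relabel_unitKronecker_matMul e _

/-- `2^N ∤ 3^N` for `N ≥ 1`. [folklore] -/
theorem two_pow_not_dvd_three_pow {N : ℕ} (hN : 0 < N) : ¬ 2 ^ N ∣ 3 ^ N := by
  intro h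
  have h2 : 2 ∣ 3 ^ N := (dvd_pow_self 2 hN.ne').trans h
  have := Nat.Prime.dvd_of_dvd_pow Nat.prime_two h2
  omega

/-- **Incomparability, forward: for `N ≥ 1`, `⟨n⟩ ⊠ cw₂^{⊠N} ⋭ e^*(⟨n'⟩ ⊠ ⟨m,m,m⟩)` for EVERY `n', m ≥ 1` and
every relabelling `e`** (`m = 2^N` from `minrank`, `m ∣ 3^N` from slice parity). [cite: KempfNess1979, Thm. 0.2] -/
theorem not_degeneratesTo_of_pos {n N n' m : ℕ} (hN : 0 < N) (hn' : 0 < n') (hm : 0 < m)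
    (e : (Fin n × (Fin N → Fin 3)) ≃ (Fin n' × (Fin m × Fin m))) :
    ¬ TensorDegeneratesTo (kroneckerTensor (unitTensor ℂ n) (kroneckerPow (cwTensor ℂ 2) N))
      (fun a b c => kroneckerTensor (unitTensor ℂ n') (matMulTensor ℂ m m m) (e a) (e b) (e c)) :=
  fun h => two_pow_not_dvd_three_pow hN
    (eq_two_pow_of_degeneratesTo hn' hm e h ▸ dvd_three_pow_of_degeneratesTo hn' hm e h)

/-- **Incomparability, reverse: for `N ≥ 1`, `e^*(⟨n'⟩ ⊠ ⟨m,m,m⟩) ⋭ ⟨n⟩ ⊠ cw₂^{⊠N}`.** [cite: KempfNess1979, Thm. 0.2] -/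
theorem not_degeneratesTo_rev_of_pos {n N n' m : ℕ} (hN : 0 < N) (hn' : 0 < n') (hm : 0 < m)
    (e : (Fin n × (Fin N → Fin 3)) ≃ (Fin n' × (Fin m × Fin m))) :
    ¬ TensorDegeneratesTo
      (fun a b c => kroneckerTensor (unitTensor ℂ n') (matMulTensor ℂ m m m) (e a) (e b) (e c))
      (kroneckerTensor (unitTensor ℂ n) (kroneckerPow (cwTensor ℂ 2) N)) :=
  fun h => two_pow_not_dvd_three_pow hN
    (eq_two_pow_of_degeneratesTo_rev hn' hm e h ▸ dvd_three_pow_of_degeneratesTo_rev hn' hm e h)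

/-- No restriction in either direction between `⟨n⟩ ⊠ cw₂^{⊠N}` (`N ≥ 1`) and `⟨n'⟩ ⊠ ⟨m,m,m⟩` of the same
format. [cite: KempfNess1979, Thm. 0.2] -/
theorem not_restrictsTo_of_pos {n N n' m : ℕ} (hN : 0 < N) (hn' : 0 < n') (hm : 0 < m)
    (hfmt : n * 3 ^ N = n' * (m * m)) :
    ¬ TensorRestrictsTo (kroneckerTensor (unitTensor ℂ n) (kroneckerPow (cwTensor ℂ 2) N))
        (kroneckerTensor (unitTensor ℂ n') (matMulTensor ℂ m m m)) ∧
      ¬ TensorRestrictsTo (kroneckerTensor (unitTensor ℂ n') (matMulTensor ℂ m m m))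
        (kroneckerTensor (unitTensor ℂ n) (kroneckerPow (cwTensor ℂ 2) N)) :=
  ⟨fun h => not_degeneratesTo_of_pos hN hn' hm (Fintype.equivOfCardEq (card_eq_of_format hfmt))
      (tensorDegeneratesTo_of_restrictsTo
        (tensorRestrictsTo_relabel (Fintype.equivOfCardEq (card_eq_of_format hfmt)) h)),
    fun h => not_degeneratesTo_rev_of_pos hN hn' hm (Fintype.equivOfCardEq (card_eq_of_format hfmt))
      (tensorDegeneratesTo_of_restrictsTo
        (tensorRestrictsTo_relabel_source (Fintype.equivOfCardEq (card_eq_of_format hfmt)) h))⟩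

/-- **No `ℂ[ε]`-degeneration of any order, in either direction**, between `⟨n⟩ ⊠ cw₂^{⊠N}` (`N ≥ 1`) and
`⟨n'⟩ ⊠ ⟨m,m,m⟩` of the same format. [cite: BurgisserClausenShokrollahi1997, (15.19)] [cite: KempfNess1979, Thm. 0.2] -/
theorem not_algDegeneratesTo_of_pos {n N n' m : ℕ} (hN : 0 < N) (hn' : 0 < n') (hm : 0 < m)
    (hfmt : n * 3 ^ N = n' * (m * m)) :
    ¬ AlgDegeneratesTo (kroneckerTensor (unitTensor ℂ n) (kroneckerPow (cwTensor ℂ 2) N))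
        (kroneckerTensor (unitTensor ℂ n') (matMulTensor ℂ m m m)) ∧
      ¬ AlgDegeneratesTo (kroneckerTensor (unitTensor ℂ n') (matMulTensor ℂ m m m))
        (kroneckerTensor (unitTensor ℂ n) (kroneckerPow (cwTensor ℂ 2) N)) := by
  classical
  refine ⟨not_algDegeneratesTo_of_not_degeneratesTo_relabel
      (Fintype.equivOfCardEq (card_eq_of_format hfmt)) (not_degeneratesTo_of_pos hN hn' hm _),
    fun h => ?_⟩
  set e := Fintype.equivOfCardEq (card_eq_of_format hfmt) with he
  have hres : TensorRestrictsTo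
      (fun a b c => kroneckerTensor (unitTensor ℂ n') (matMulTensor ℂ m m m) (e a) (e b) (e c))
      (kroneckerTensor (unitTensor ℂ n') (matMulTensor ℂ m m m)) :=
    tensorRestrictsTo_relabel_source e (TensorRestrictsTo.refl _)
  exact not_degeneratesTo_rev_of_pos hN hn' hm e
    (tensorDegeneratesTo_of_algDegeneratesTo (hres.algDegeneratesTo_trans h))

/-- The same in Alman's convention, both directions. [cite: Alman2021, §2.4] [cite: KempfNess1979, Thm. 0.2] -/
theorem not_polyDegeneratesTo_of_pos {n N n' m : ℕ} (hN : 0 < N) (hn' : 0 < n') (hm : 0 < m)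
    (hfmt : n * 3 ^ N = n' * (m * m)) :
    ¬ PolyDegeneratesTo (kroneckerTensor (unitTensor ℂ n) (kroneckerPow (cwTensor ℂ 2) N))
        (kroneckerTensor (unitTensor ℂ n') (matMulTensor ℂ m m m)) ∧
      ¬ PolyDegeneratesTo (kroneckerTensor (unitTensor ℂ n') (matMulTensor ℂ m m m))
        (kroneckerTensor (unitTensor ℂ n) (kroneckerPow (cwTensor ℂ 2) N)) :=
  ⟨fun h => (not_algDegeneratesTo_of_pos hN hn' hm hfmt).1
      (ConverseDoorLimit.algDegeneratesTo_of_polyDegeneratesTo h),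
    fun h => (not_algDegeneratesTo_of_pos hN hn' hm hfmt).2
      (ConverseDoorLimit.algDegeneratesTo_of_polyDegeneratesTo h)⟩

end Parity

/-! ## §2  The exchange ladder: every rung `p/q` (`q ≥ 1`), every level `L ≥ 1`, both directions -/

section Rungs

/-- **Rung `p/q` of the exchange ladder, ANY slope (`q ≥ 1`), level `L ≥ 1`: `⟨4^{pL}⟩ ⊠ cw₂^{⊠qL}` and
`⟨3^{qL}⟩ ⊠ ⟨2^{pL},2^{pL},2^{pL}⟩` are `ℂ[ε]`-degeneration-incomparable** — including the slope-one rungs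
`p = q` left open by `minrank`. [cite: KempfNess1979, Thm. 0.2] [cite: BurgisserClausenShokrollahi1997, (15.19)] -/
theorem rung_incomparable {p q L : ℕ} (hq : 0 < q) (hL : 0 < L) :
    ¬ AlgDegeneratesTo
        (kroneckerTensor (unitTensor ℂ (4 ^ (p * L))) (kroneckerPow (cwTensor ℂ 2) (q * L)))
        (kroneckerTensor (unitTensor ℂ (3 ^ (q * L)))
          (matMulTensor ℂ (2 ^ (p * L)) (2 ^ (p * L)) (2 ^ (p * L)))) ∧
      ¬ AlgDegeneratesTo
        (kroneckerTensor (unitTensor ℂ (3 ^ (q * L)))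
          (matMulTensor ℂ (2 ^ (p * L)) (2 ^ (p * L)) (2 ^ (p * L))))
        (kroneckerTensor (unitTensor ℂ (4 ^ (p * L))) (kroneckerPow (cwTensor ℂ 2) (q * L))) :=
  not_algDegeneratesTo_of_pos (Nat.mul_pos hq hL) (by positivity) (by positivity) (rung_format p q L)

/-- Rung `p/q` (`q ≥ 1`, `L ≥ 1`): no restriction in either direction. [cite: KempfNess1979, Thm. 0.2] -/
theorem rung_not_restrictsTo_either {p q L : ℕ} (hq : 0 < q) (hL : 0 < L) :
    ¬ TensorRestrictsTo
        (kroneckerTensor (unitTensor ℂ (4 ^ (p * L))) (kroneckerPow (cwTensor ℂ 2) (q * L)))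
        (kroneckerTensor (unitTensor ℂ (3 ^ (q * L)))
          (matMulTensor ℂ (2 ^ (p * L)) (2 ^ (p * L)) (2 ^ (p * L)))) ∧
      ¬ TensorRestrictsTo
        (kroneckerTensor (unitTensor ℂ (3 ^ (q * L)))
          (matMulTensor ℂ (2 ^ (p * L)) (2 ^ (p * L)) (2 ^ (p * L))))
        (kroneckerTensor (unitTensor ℂ (4 ^ (p * L))) (kroneckerPow (cwTensor ℂ 2) (q * L))) :=
  not_restrictsTo_of_pos (Nat.mul_pos hq hL) (by positivity) (by positivity) (rung_format p q L)

/-- **The slope-one pair at level one: `⟨4⟩ ⊠ cw₂^{⊠1}` and `⟨3⟩ ⊠ ⟨2,2,2⟩` (format `12`, equal minranks `2`)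
are degeneration-incomparable** — decided by slice parity (`cw` side has a slice of rank `3`, all
`⟨3⟩ ⊠ ⟨2,2,2⟩` slices have even rank). [cite: KempfNess1979, Thm. 0.2] -/
theorem fourCwTwo_threeMatMulTwo_incomparable :
    ¬ AlgDegeneratesTo (kroneckerTensor (unitTensor ℂ 4) (kroneckerPow (cwTensor ℂ 2) 1))
        (kroneckerTensor (unitTensor ℂ 3) (matMulTensor ℂ 2 2 2)) ∧
      ¬ AlgDegeneratesTo (kroneckerTensor (unitTensor ℂ 3) (matMulTensor ℂ 2 2 2))
        (kroneckerTensor (unitTensor ℂ 4) (kroneckerPow (cwTensor ℂ 2) 1)) :=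
  not_algDegeneratesTo_of_pos (by norm_num) (by norm_num) (by norm_num) (by norm_num)

/-- The slope-one rung `1/1` at level two: `⟨16⟩ ⊠ cw₂^{⊠2}` vs `⟨9⟩ ⊠ ⟨4,4,4⟩` (format `144`), incomparable.
[cite: KempfNess1979, Thm. 0.2] -/
theorem sixteenCwTwoSq_nineMatMulFour_incomparable :
    ¬ AlgDegeneratesTo (kroneckerTensor (unitTensor ℂ 16) (kroneckerPow (cwTensor ℂ 2) 2))
        (kroneckerTensor (unitTensor ℂ 9) (matMulTensor ℂ 4 4 4)) ∧
      ¬ AlgDegeneratesTo (kroneckerTensor (unitTensor ℂ 9) (matMulTensor ℂ 4 4 4))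
        (kroneckerTensor (unitTensor ℂ 16) (kroneckerPow (cwTensor ℂ 2) 2)) :=
  not_algDegeneratesTo_of_pos (by norm_num) (by norm_num) (by norm_num) (by norm_num)

end Rungs

end Summit.MatrixMultiplication.MatrixMultiplication.Theorems.OutsiderSandwichFiniteShadow

end
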